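import Literature.NumberTheory.Sieve.MaynardTaoOfSiegelWalfisz
import Literature.NumberTheory.Sieve.MaynardSieveLemma63Sum
import Literature.NumberTheory.Sieve.MaynardSieveYm
import Literature.NumberTheory.Sieve.MaynardSieveLemma52
import Literature.NumberTheory.Sieve.GoldstonGrahamPintzYildirimLemma3
import Literature.NumberTheory.Sieve.GoldstonGrahamPintzYildirimProofs
import Literature.NumberTheory.LFunctions.SiegelWalfisz
import Literature.NumberTheory.Sieve.GoldstonPintzYildirimProofs
import HarnessLib

/-!
# `liminf (p_{n+1} − p_n)/log p_n = 0` (parity.S30): the discharge routes, assembled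

Topic `Literature/NumberTheory/Sieve`; sibling proof file (theorems only) of `ParityWave0.lean` for
the named fact `Literature.NumberTheory.Sieve.frequently_nth_prime_gap_lt_mul_log` — Goldston–Pintz–Yıldırım,
*Primes in tuples I*, Ann. of Math. 170 (2009), **Theorem 2**, display (1.8):
`E₁ = liminf_{n→∞} (p_{n+1} − p_n)/log p_n = 0`.

Two routes to its discharge exist in the tree; this leaf file (it imports both developments, which
`ParityWave0Proofs.lean` cannot do, being upstream of the Maynard files) composes each of them down
to the named facts that are still open, so that `frequently_nth_prime_gap_lt_mul_log_holds` is a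
one-line application once those land.

* **GPY's own proof** (§3 of the paper, positivity of the twisted second moment of `Λ_R(n; H, ℓ)`):
  `Literature.NumberTheory.Sieve.GPY.frequently_nth_prime_gap_lt_mul_log_of_proposition1_of_proposition2`
  (`GoldstonPintzYildirimProofs.lean`; Gallagher's singular-series average (3.7) is discharged
  there). Open inputs: `Literature.NumberTheory.Sieve.GPY.proposition1` (Prop. 1, §§6–8) and `Literature.NumberTheory.Sieve.GPY.proposition2`
  (Prop. 2, §9, which rests on the Bombieri–Vinogradov theorem).
* **Bounded gaps** (Maynard, Ann. of Math. 181 (2015), Thm 1.1, which GPY could not reach: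
  "`p_{n+1} − p_n ≤ 16` infinitely often" is recorded after (1.7) as conditional on a level
  `ϑ > 0.971`): `frequently_nth_prime_gap_lt_mul_log_of_maynard_tao` below (`m = 1` in
  `liminf (p_{n+m} − p_n) ≪ m³ e^{4m}` gives bounded gaps, and bounded gaps give (1.8) because
  `ε log p_n → ∞`, `frequently_nth_prime_gap_lt_mul_log_of_frequently_le_add`). By
  `Literature.NumberTheory.Sieve.frequently_nth_prime_add_le_maynard_tao_of_siegelWalfisz_of_asymptotics`
  (`MaynardTaoOfSiegelWalfisz.lean`) and the proved `S₁` half `Literature.NumberTheory.Sieve.maynard_S1_asymptotic_holds`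
  (`MaynardSieveLemma62.lean`), the open inputs on this route are exactly
  `Literature.NumberTheory.Sieve.siegel_walfisz` (parity.S28) and `Literature.NumberTheory.Sieve.maynard_S2_asymptotic` (Maynard's Lemma 6.3),
  the latter reduced by `Literature.NumberTheory.Sieve.maynard_S2_asymptotic_of` to `Literature.NumberTheory.Sieve.maynard_lemma52` and
  `Literature.NumberTheory.Sieve.maynard_lemma63_ym` (`Literature.NumberTheory.Sieve.maynard_lemma63_sum_holds` being proved in
  `MaynardSieveLemma63Sum.lean`).

Update (the inputs as they landed). `Literature.NumberTheory.LFunctions.siegel_walfisz_holds`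
(`Literature/NumberTheory/LFunctions/SiegelWalfisz.lean`) discharges parity.S28;
`Literature.NumberTheory.Sieve.GGPY.moebiusSqGSum_asymptotic_holds` (`GoldstonGrahamPintzYildirimLemma3.lean`, GGPY 2009
Lemma 3 in dimension `κ = 1`) with `Literature.NumberTheory.Sieve.GGPY.moebiusSqGSumWeighted_asymptotic_of`
(`GoldstonGrahamPintzYildirimProofs.lean`, Lemma 4 from Lemma 3) and `Literature.NumberTheory.Sieve.maynard_lemma63_ym_of_GGPY`
(`MaynardSieveYm.lean`) discharge `Literature.NumberTheory.Sieve.maynard_lemma63_ym`. Hence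
`frequently_nth_prime_gap_lt_mul_log_of_lemma52`: on the bounded-gaps route GPY Theorem 2 rests on
Maynard's Lemma 5.2 (`Literature.NumberTheory.Sieve.maynard_lemma52`) alone; and `Literature.NumberTheory.Sieve.maynard_lemma52_holds`
(`MaynardSieveLemma52.lean`) discharges that, so the named fact is now PROVED:
`frequently_nth_prime_gap_lt_mul_log_holds` (the DISCHARGE of parity.S30, GPY Theorem 2 (1.8)),
along Maynard's bounded-gaps theorem. GPY's own route (Propositions 1–2) remains open at
`Literature.NumberTheory.Sieve.GPY.proposition1`/`proposition2`.

## References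

* D. A. Goldston, J. Pintz, C. Y. Yıldırım, *Primes in tuples. I*, Ann. of Math. (2) 170 (2009),
  819–862, doi:10.4007/annals.2009.170.819 = arXiv:math/0508185; Theorem 2, (1.8), and the remark
  after (1.7). [cite: GoldstonPintzYildirim2009]
* J. Maynard, *Small gaps between primes*, Ann. of Math. (2) 181 (2015), 383–413; Theorem 1.1,
  Prop. 4.1, Lemmas 5.2, 6.2, 6.3. [cite: MaynardAnnals2015]
-/

namespace Literature.NumberTheory.Sieve

open Filter

/-- **GPY Theorem 2 from the Maynard–Tao theorem.** `frequently_nth_prime_add_le_maynard_tao`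
(`∃ C, ∀ m ≥ 1, ∃ᶠ n, p_{n+m} ≤ p_n + C m³ e^{4m}`) at `m = 1` is bounded gaps
`p_{n+1} ≤ p_n + C e⁴` infinitely often, whence `liminf (p_{n+1} − p_n)/log p_n = 0`
(`frequently_nth_prime_gap_lt_mul_log_of_frequently_le_add`).
[cite: GoldstonPintzYildirim2009, Theorem 2 (1.8) and the remark after (1.7)] -/
theorem frequently_nth_prime_gap_lt_mul_log_of_maynard_tao
    (h : frequently_nth_prime_add_le_maynard_tao) : frequently_nth_prime_gap_lt_mul_log := by
  obtain ⟨C, hC⟩ := h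
  refine frequently_nth_prime_gap_lt_mul_log_of_frequently_le_add
    ⟨C * (1 : ℕ) ^ 3 * Real.exp (4 * (1 : ℕ)), ?_⟩
  exact hC 1 le_rfl

/-- **GPY Theorem 2 from Siegel–Walfisz and Maynard's Lemma 6.3.** On the bounded-gaps route the
fact rests on `siegel_walfisz` (⟹ Bombieri–Vinogradov, `bombieri_vinogradov_of_siegelWalfisz`) and
the `S₂` asymptotic `maynard_S2_asymptotic`; the `S₁` asymptotic is `maynard_S1_asymptotic_holds`.
[cite: MaynardAnnals2015, Theorem 1.1, Prop. 4.1 and §4] -/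
theorem frequently_nth_prime_gap_lt_mul_log_of_siegelWalfisz_of_S2 (hSW : siegel_walfisz)
    (hS2 : maynard_S2_asymptotic) : frequently_nth_prime_gap_lt_mul_log :=
  frequently_nth_prime_gap_lt_mul_log_of_maynard_tao
    (frequently_nth_prime_add_le_maynard_tao_of_siegelWalfisz_of_asymptotics hSW
      maynard_S1_asymptotic_holds hS2)

/-- The same with `maynard_S2_asymptotic` opened up by `maynard_S2_asymptotic_of`: GPY Theorem 2
from `siegel_walfisz`, Maynard's Lemma 5.2 (`maynard_lemma52`) and the evaluation of `y^{(m)}`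
in the proof of Lemma 6.3 (`maynard_lemma63_ym`); the smooth sum of that proof is
`maynard_lemma63_sum_holds`. [cite: MaynardAnnals2015, Lemmas 5.2 and 6.3] -/
theorem frequently_nth_prime_gap_lt_mul_log_of_siegelWalfisz_of_lemma52_of_ym
    (hSW : siegel_walfisz) (h52 : maynard_lemma52) (hym : maynard_lemma63_ym) :
    frequently_nth_prime_gap_lt_mul_log :=
  frequently_nth_prime_gap_lt_mul_log_of_siegelWalfisz_of_S2 hSW
    (maynard_S2_asymptotic_of h52 hym maynard_lemma63_sum_holds)

/-- GPY Theorem 2 from `siegel_walfisz` and the smooth form of Maynard's Prop. 4.2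
(`frequently_card_primes_ge_of_maynardFunctional_smooth`), through
`frequently_nth_prime_add_le_maynard_tao_of_siegelWalfisz_of_smooth`.
[cite: MaynardAnnals2015, Theorem 1.1, Prop. 4.2 and §4] -/
theorem frequently_nth_prime_gap_lt_mul_log_of_siegelWalfisz_of_smooth (hSW : siegel_walfisz)
    (h42 : frequently_card_primes_ge_of_maynardFunctional_smooth) :
    frequently_nth_prime_gap_lt_mul_log :=
  frequently_nth_prime_gap_lt_mul_log_of_maynard_tao
    (frequently_nth_prime_add_le_maynard_tao_of_siegelWalfisz_of_smooth hSW h42)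

/-- **Either route.** GPY Theorem 2 holds as soon as either GPY's Propositions 1 and 2 are
available (the paper's own §3 argument, `Literature.NumberTheory.Sieve.GPY.frequently_nth_prime_gap_lt_mul_log_of_proposition1_of_proposition2`)
or Siegel–Walfisz and Maynard's `S₂` asymptotic are.
[cite: GoldstonPintzYildirim2009, Theorem 2 (1.8), §3] -/
theorem frequently_nth_prime_gap_lt_mul_log_of_or
    (h : (Literature.NumberTheory.Sieve.GPY.proposition1 ∧ Literature.NumberTheory.Sieve.GPY.proposition2) ∨
      (siegel_walfisz ∧ maynard_S2_asymptotic)) :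
    frequently_nth_prime_gap_lt_mul_log := by
  rcases h with ⟨h₁, h₂⟩ | ⟨hSW, hS2⟩
  · exact Literature.NumberTheory.Sieve.GPY.frequently_nth_prime_gap_lt_mul_log_of_proposition1_of_proposition2 h₁ h₂
  · exact frequently_nth_prime_gap_lt_mul_log_of_siegelWalfisz_of_S2 hSW hS2

/-- **GPY Theorem 2 from Maynard's Lemma 5.2 alone.** With Siegel–Walfisz proved
(`siegel_walfisz_holds`) and the `y^{(m)}` evaluation of the proof of Maynard's Lemma 6.3
(`maynard_lemma63_ym`) obtained from GGPY 2009 Lemma 3 in dimension `κ = 1`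
(`GGPY.moebiusSqGSum_asymptotic_holds`), Lemma 4 from Lemma 3
(`GGPY.moebiusSqGSumWeighted_asymptotic_of`) and `maynard_lemma63_ym_of_GGPY`, the reduction
`frequently_nth_prime_gap_lt_mul_log_of_siegelWalfisz_of_lemma52_of_ym` leaves Maynard's Lemma 5.2
(`maynard_lemma52`) as the only open input on the bounded-gaps route to
`liminf (p_{n+1} − p_n)/log p_n = 0`. [cite: GoldstonPintzYildirim2009, Theorem 2 (1.8)] -/
theorem frequently_nth_prime_gap_lt_mul_log_of_lemma52 (h52 : maynard_lemma52) :
    frequently_nth_prime_gap_lt_mul_log :=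
  frequently_nth_prime_gap_lt_mul_log_of_siegelWalfisz_of_lemma52_of_ym LFunctions.siegel_walfisz_holds h52
    (maynard_lemma63_ym_of_GGPY
      (GGPY.moebiusSqGSumWeighted_asymptotic_of GGPY.moebiusSqGSum_asymptotic_holds))

/-- **DISCHARGE of parity.S30 — Goldston–Pintz–Yıldırım, Theorem 2 (1.8):
`liminf_{n→∞} (p_{n+1} − p_n)/log p_n = 0`**, i.e. for every `ε > 0`, `p_{n+1} − p_n < ε log p_n`
for infinitely many `n`. Proved along the bounded-gaps route: Siegel–Walfisz
(`siegel_walfisz_holds`) ⟹ Bombieri–Vinogradov (Vaughan's identity and the large sieve,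
`bombieri_vinogradov_of_siegelWalfisz`) ⟹ with Maynard's sieve (Prop. 4.1 = Lemmas 5.1–6.3:
`maynard_S1_asymptotic_holds`, `maynard_lemma52_holds`, `maynard_lemma63_sum_holds`, the `y^{(m)}`
evaluation via GGPY 2009 Lemmas 3–4) and Prop. 4.3(3) (`exists_maynardFunctional_gt_holds`)
Maynard's Theorem 1.1, `liminf (p_{n+m} − p_n) ≪ m³ e^{4m}`; at `m = 1` bounded gaps, whence (1.8)
because `ε log p_n → ∞`. (GPY's own §3 proof from their Propositions 1 and 2 is
`Literature.NumberTheory.Sieve.GPY.frequently_nth_prime_gap_lt_mul_log_of_proposition1_of_proposition2`; those two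
propositions remain named facts.) [cite: GoldstonPintzYildirim2009, Theorem 2 (1.8)] -/
theorem frequently_nth_prime_gap_lt_mul_log_holds : frequently_nth_prime_gap_lt_mul_log :=
  frequently_nth_prime_gap_lt_mul_log_of_lemma52 maynard_lemma52_holds

end Literature.NumberTheory.Sieve
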